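import Mathlib
import Summits.ResolutionOfSingularities.ResolutionOfSingularities.Theses.HomologicalConductor
import Summits.ResolutionOfSingularities.ResolutionOfSingularities.Theorems.HomologicalConductorPersistenceRefutation
import HarnessLib

/-!
# `NoZeno` (stmt-ResolutionOfSingularities-16483) holds — VACUOUSLY, from `¬ Persistence`

[OURS · cell res-hironaka · LADDER-RESOLUTION L ★L-G4 W4.4 · res-L0-w44-lead-1 (lead prover), chain W4.4 / W4.4b]
AI-written and AI-refereed only (weaker than expert review). NOT a statement of the manuscript under review
(Hironaka 2017); nothing here is attributed to it, and nothing here says anything about resolution of singularities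
in positive characteristic.

WHAT THIS FILE PROVES AND WHAT IT DOES NOT. The route item `NoZeno` is typed
`⟨Persistence-statement⟩ → ⟨StrictDrop-statement⟩ → ⟨valuative termination of the canonical normalised ca-tower⟩`,
its first binder being the statement of the aside item `Persistence` (stmt-16484) VERBATIM. Chain W4.4b's K-C3
counterexample (`Summit.ResolutionOfSingularities.ResolutionOfSingularities.Theorems.not_Persistence`, file
`Theorems/HomologicalConductorPersistenceRefutation.lean`: the E₆ compound Du Val datum `xy = z³ + t⁴`,
`A = k[x,z,t,(z³+t⁴)/x]`, `O = O_(6,5,4)`, `k = ZMod 5`, stage `m = 0`: `x ∈ ca(T₀) ∖ ca(T₁)`) refutes exponent-one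
`Persistence`, so `NoZeno` holds EX FALSO. This is VACUOUS: it says NOTHING about termination of the ca-tower. The live
statement of record is the twin crux `NoZenoR` (stmt-ResolutionOfSingularities-19943: the same conclusion under the
PROVED radical persistence `PersistenceRadical`, p471149), whose registered skeleton (v31, 7 open stubs) is this chain's
object; the route's deciding theorem `closes` consumes `NoZenoR`, not `NoZeno`.
-/

namespace Summit.ResolutionOfSingularities.ResolutionOfSingularities.Theorems

-- single-problem summit: the doubled namespace component `ResolutionOfSingularities` is forced by the layout
set_option linter.dupNamespace false

open Summit.ResolutionOfSingularities.ResolutionOfSingularities.Theses.HomologicalConductor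

/-- `NoZeno` (stmt-ResolutionOfSingularities-16483) holds, vacuously: its first hypothesis is the statement of
`Persistence`, refuted in the tree by `Theorems.not_Persistence` (chain W4.4b, K-C3). Says nothing about termination;
the statement with content is `NoZenoR` (stmt-ResolutionOfSingularities-19943). [OURS; vacuous closure] -/
theorem noZeno_proof : NoZeno := fun hP _ => absurd hP not_Persistence

end Summit.ResolutionOfSingularities.ResolutionOfSingularities.Theorems
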